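import Mathlib
import HarnessLib

/-!
# Route `CylinderEntropy`, item `ImmortalAreaToFloor` (stmt-SmoothPoincare4-17197):
# Gaussian mass of Euclidean balls in `ℝ⁴` and the layer-cake transfer to dense sets

Brick (KM, Euclidean half) of the Allard-free blueprint for the residual `ThinSeq` of the item (evidence
`ANALYSIS-prover-17197-c1.md`, §6, CASE 0 of the per-ball lemma): the typed cylinder density of a coherent double
layer is bounded BELOW by twice the Gaussian mass of the set of columns carrying it, and that set is only known
to be dense in every CENTRED ball.  This file PROVES the two Euclidean facts this needs, in
`EuclideanSpace ℝ (Fin 4)` with Lebesgue measure: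

* `integral_Ioi_exp_neg_mul_sq_le` — the Gaussian tail `∫_{s > a} e^{-b s²} ds ≤ e^{-b a²} / (2ab)` (`a, b > 0`);
* `le_intervalIntegral_exp_neg_mul_sq` — hence `∫_0^a e^{-b s²} ds ≥ √(π/b)/2 - e^{-b a²}/(2ab)`
  (`integral_gaussian_Ioi`);
* `setIntegral_cube_exp_neg_mul_norm_sq` — the mass of the centred cube `{|yᵢ| ≤ a}` is the fourth power of
  `∫_{-a}^{a} e^{-b s²} ds` (Fubini, `integral_fintype_prod_volume_eq_pow`, transported along the volume-preserving
  `WithLp` equivalence);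
* `le_setIntegral_closedBall_exp_neg_mul_norm_sq` — **Gaussian mass of a ball**: the cube of half-side `R/2` lies in
  the ball of radius `R`, so `∫_{‖y‖ ≤ R} e^{-b‖y‖²} dy ≥ (√(π/b) - 2 e^{-b R²/4}/(R b))⁴` whenever the bracket is
  non-negative — with `b = 1/(4τ)` and `R = L √τ` this is `(4πτ)² (1 - (4/(L√π)) e^{-L²/16})⁴`, i.e. the normalised
  mass `→ 1` as `L → ∞`, uniformly in `τ`;
* `lintegral_inter_ge_of_dense_in_balls` — **layer-cake transfer**: if a measurable `G` has
  `vol(G ∩ B(0,r)) ≥ (1-θ) vol(B(0,r))` for every `r ∈ (0, R]`, then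
  `∫_{G ∩ B(0,R)} e^{-b‖y‖²} ≥ (1-θ) ∫_{B(0,R)} e^{-b‖y‖²}` (the super-level sets of the radial kernel inside `B(0,R)`
  are centred balls).

Everything is proved; no definition, no named fact.

References: standard (Gaussian tail bound; layer-cake formula, e.g. E. H. Lieb, M. Loss, *Analysis*, Thm. 1.13).
-/

noncomputable section

-- the prescribed namespace `Summit.SmoothPoincare4.SmoothPoincare4.…` repeats `SmoothPoincare4`
set_option linter.dupNamespace false

open MeasureTheory Set Filter Real intervalIntegral
open scoped ENNReal NNReal Topology BigOperators

namespace Summit.SmoothPoincare4.SmoothPoincare4.Theorems.GaussianMass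

/-! ## One dimension: tail and central mass -/

/-- **Gaussian tail bound**: `∫_{s > a} e^{-b s²} ds ≤ e^{-b a²} / (2ab)` for `a, b > 0` (compare with
`(s/a) e^{-b s²}`, whose primitive is `-e^{-b s²}/(2ab)`). [folklore] -/
theorem integral_Ioi_exp_neg_mul_sq_le {a b : ℝ} (ha : 0 < a) (hb : 0 < b) :
    ∫ s in Ioi a, exp (-b * s ^ 2) ≤ exp (-b * a ^ 2) / (2 * a * b) := by
  -- the majorant `(s/a) e^{-b s²}` and its primitive
  set F : ℝ → ℝ := fun s => -(exp (-b * s ^ 2) / (2 * a * b)) with hF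
  set F' : ℝ → ℝ := fun s => s / a * exp (-b * s ^ 2) with hF'
  have hderiv : ∀ s, HasDerivAt F (F' s) s := by
    intro s
    have h1 : HasDerivAt (fun s => -b * s ^ 2) (-b * (2 * s)) s := by
      simpa using ((hasDerivAt_pow 2 s).const_mul (-b))
    have h2 : HasDerivAt (fun s => exp (-b * s ^ 2)) (exp (-b * s ^ 2) * (-b * (2 * s))) s :=
      h1.exp
    have h3 : HasDerivAt F (-(exp (-b * s ^ 2) * (-b * (2 * s)) / (2 * a * b))) s :=
      (h2.div_const (2 * a * b)).neg
    have h4 : -(exp (-b * s ^ 2) * (-b * (2 * s)) / (2 * a * b)) = F' s := by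
      rw [hF']
      field_simp
    rw [h4] at h3
    exact h3
  have hF'nn : ∀ s ∈ Ioi a, 0 ≤ F' s := fun s hs =>
    mul_nonneg (div_nonneg (ha.le.trans (le_of_lt hs)) ha.le) (exp_pos _).le
  have hlim : Tendsto F atTop (𝓝 0) := by
    have h1 : Tendsto (fun s : ℝ => -b * s ^ 2) atTop atBot := by
      have := (tendsto_pow_atTop (α := ℝ) two_ne_zero).const_mul_atTop_of_neg (neg_lt_zero.2 hb)
      simpa using this
    have h2 : Tendsto (fun s : ℝ => exp (-b * s ^ 2)) atTop (𝓝 0) := tendsto_exp_atBot.comp h1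
    have h3 := (h2.div_const (2 * a * b)).neg
    simpa [hF] using h3
  have hcont : ContinuousWithinAt F (Ici a) a := (hderiv a).continuousAt.continuousWithinAt
  have hint : IntegrableOn F' (Ioi a) :=
    integrableOn_Ioi_deriv_of_nonneg hcont (fun s _ => hderiv s) hF'nn hlim
  have hval : ∫ s in Ioi a, F' s = 0 - F a :=
    integral_Ioi_of_hasDerivAt_of_tendsto hcont (fun s _ => hderiv s) hint hlim
  -- comparison
  have hgi : IntegrableOn (fun s => exp (-b * s ^ 2)) (Ioi a) := (integrable_exp_neg_mul_sq hb).integrableOn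
  calc ∫ s in Ioi a, exp (-b * s ^ 2) ≤ ∫ s in Ioi a, F' s := by
        refine setIntegral_mono_on hgi hint measurableSet_Ioi fun s hs => ?_
        rw [hF']
        have h1 : 1 ≤ s / a := (one_le_div ha).2 (le_of_lt hs)
        nlinarith [exp_pos (-b * s ^ 2)]
    _ = exp (-b * a ^ 2) / (2 * a * b) := by rw [hval, hF]; ring

/-- **Central Gaussian mass on `[0, a]`**: `∫_0^a e^{-b s²} ds ≥ √(π/b)/2 - e^{-b a²}/(2ab)` for `a, b > 0`
(`∫_{s>0} = √(π/b)/2`, `integral_gaussian_Ioi`, minus the tail). [folklore] -/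
theorem le_intervalIntegral_exp_neg_mul_sq {a b : ℝ} (ha : 0 < a) (hb : 0 < b) :
    √(π / b) / 2 - exp (-b * a ^ 2) / (2 * a * b) ≤ ∫ s in (0 : ℝ)..a, exp (-b * s ^ 2) := by
  have hgi : Integrable (fun s : ℝ => exp (-b * s ^ 2)) := integrable_exp_neg_mul_sq hb
  have hsplit : ∫ s in Ioi (0 : ℝ), exp (-b * s ^ 2) =
      (∫ s in Ioc (0 : ℝ) a, exp (-b * s ^ 2)) + ∫ s in Ioi a, exp (-b * s ^ 2) := by
    rw [← Ioc_union_Ioi_eq_Ioi ha.le, setIntegral_union (Ioc_disjoint_Ioi (le_refl a)) measurableSet_Ioi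
      hgi.integrableOn hgi.integrableOn]
  rw [integral_of_le ha.le]
  have htail := integral_Ioi_exp_neg_mul_sq_le ha hb
  rw [integral_gaussian_Ioi b] at hsplit
  linarith

/-- The Gaussian is even: `∫_{-a}^{a} e^{-b s²} = 2 ∫_0^a e^{-b s²}`. [folklore] -/
theorem intervalIntegral_neg_eq_two_mul (a b : ℝ) :
    ∫ s in (-a)..a, exp (-b * s ^ 2) = 2 * ∫ s in (0 : ℝ)..a, exp (-b * s ^ 2) := by
  have hgi : ∀ u v : ℝ, IntervalIntegrable (fun s : ℝ => exp (-b * s ^ 2)) volume u v := fun u v =>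
    (continuous_exp.comp (continuous_const.mul (continuous_pow 2))).intervalIntegrable u v
  have h1 : ∫ s in (-a)..0, exp (-b * s ^ 2) = ∫ s in (0 : ℝ)..a, exp (-b * s ^ 2) := by
    have h := intervalIntegral.integral_comp_neg (a := 0) (b := a) (fun s : ℝ => exp (-b * s ^ 2))
    simp only [neg_zero, even_two, Even.neg_pow] at h
    rw [← h]
  rw [← integral_add_adjacent_intervals (hgi (-a) 0) (hgi 0 a), h1]
  ring

/-! ## Four dimensions: cubes and balls -/

/-- **Mass of the centred cube**: in `EuclideanSpace ℝ (Fin 4)`,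
`∫_{{|yᵢ| ≤ a ∀ i}} e^{-b ‖y‖²} dy = (∫_{-a}^{a} e^{-b s²} ds)⁴` (the integrand is the product of the
one-dimensional Gaussians; Fubini `integral_fintype_prod_volume_eq_pow` on `Fin 4 → ℝ`, transported along the
volume-preserving `WithLp` equivalence). [folklore] -/
theorem setIntegral_cube_exp_neg_mul_norm_sq {a : ℝ} (ha : 0 ≤ a) (b : ℝ) :
    ∫ y in {y : EuclideanSpace ℝ (Fin 4) | ∀ i, y i ∈ Icc (-a) a}, exp (-b * ‖y‖ ^ 2) =
      (∫ s in (-a)..a, exp (-b * s ^ 2)) ^ 4 := by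
  classical
  -- the set integral as an integral of an indicator product over the whole space
  set g : ℝ → ℝ := fun s => (Icc (-a) a).indicator (fun s => exp (-b * s ^ 2)) s with hg
  have hprod : ∀ y : EuclideanSpace ℝ (Fin 4),
      ({y : EuclideanSpace ℝ (Fin 4) | ∀ i, y i ∈ Icc (-a) a}).indicator
        (fun y => exp (-b * ‖y‖ ^ 2)) y = ∏ i, g (y i) := by
    intro y
    by_cases hy : ∀ i, y i ∈ Icc (-a) a
    · rw [indicator_of_mem (show y ∈ {y : EuclideanSpace ℝ (Fin 4) | ∀ i, y i ∈ Icc (-a) a} from hy)]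
      have : ∀ i, g (y i) = exp (-b * y i ^ 2) := fun i => by
        simp only [hg, indicator_of_mem (hy i)]
      simp_rw [this, ← exp_sum, ← Finset.mul_sum]
      congr 1
      rw [EuclideanSpace.norm_eq, sq_sqrt (Finset.sum_nonneg fun i _ => sq_nonneg _)]
      simp_rw [Real.norm_eq_abs, sq_abs]
    · rw [indicator_of_notMem (show y ∉ {y : EuclideanSpace ℝ (Fin 4) | ∀ i, y i ∈ Icc (-a) a} from hy)]
      simp only [not_forall] at hy
      obtain ⟨i, hi⟩ := hy
      symm
      exact Finset.prod_eq_zero (Finset.mem_univ i) (by simp only [hg, indicator_of_notMem hi])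
  have hmeas : MeasurableSet {y : EuclideanSpace ℝ (Fin 4) | ∀ i, y i ∈ Icc (-a) a} := by
    have : {y : EuclideanSpace ℝ (Fin 4) | ∀ i, y i ∈ Icc (-a) a} = ⋂ i, (fun y => y i) ⁻¹' Icc (-a) a := by
      ext y; simp
    rw [this]
    exact MeasurableSet.iInter fun i =>
      measurableSet_Icc.preimage (EuclideanSpace.proj (𝕜 := ℝ) i).continuous.measurable
  rw [← MeasureTheory.integral_indicator hmeas]
  simp_rw [hprod]
  -- transport to `Fin 4 → ℝ`
  have hmp : MeasurePreserving (MeasurableEquiv.toLp 2 (Fin 4 → ℝ)) volume volume :=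
    PiLp.volume_preserving_toLp (Fin 4)
  have key := hmp.integral_comp' (g := fun y : EuclideanSpace ℝ (Fin 4) => ∏ i, g (y i))
  rw [← key]
  have : (fun x : Fin 4 → ℝ => ∏ i, g ((MeasurableEquiv.toLp 2 (Fin 4 → ℝ)) x i)) =
      fun x : Fin 4 → ℝ => ∏ i, g (x i) := by
    funext x; rfl
  rw [this, integral_fintype_prod_volume_eq_pow, Fintype.card_fin]
  -- the one-dimensional factor
  congr 1
  rw [hg, MeasureTheory.integral_indicator measurableSet_Icc]
  rcases eq_or_lt_of_le (neg_le_self ha) with h | h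
  · -- `a = 0`
    have ha0 : a = 0 := by linarith
    subst ha0
    simp
  · rw [integral_of_le (by linarith : -a ≤ a), integral_Icc_eq_integral_Ioc]

/-- The centred cube of half-side `R/2` lies in the closed ball of radius `R` (`‖y‖² = ∑ yᵢ² ≤ 4 (R/2)²`).
[folklore] -/
theorem cube_subset_closedBall {R : ℝ} (hR : 0 ≤ R) :
    {y : EuclideanSpace ℝ (Fin 4) | ∀ i, y i ∈ Icc (-(R / 2)) (R / 2)} ⊆
      Metric.closedBall (0 : EuclideanSpace ℝ (Fin 4)) R := by
  intro y hy
  rw [Metric.mem_closedBall, dist_zero_right, EuclideanSpace.norm_eq]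
  have hsum : ∑ i : Fin 4, ‖y i‖ ^ 2 ≤ ∑ _i : Fin 4, (R / 2) ^ 2 := by
    refine Finset.sum_le_sum fun i _ => ?_
    rw [Real.norm_eq_abs, sq_abs]
    have h := hy i
    rw [mem_Icc] at h
    nlinarith [h.1, h.2]
  rw [Finset.sum_const, Finset.card_univ, Fintype.card_fin] at hsum
  calc √(∑ i : Fin 4, ‖y i‖ ^ 2) ≤ √((4 : ℕ) • (R / 2) ^ 2) := sqrt_le_sqrt hsum
    _ = R := by
        rw [nsmul_eq_mul, show ((4 : ℕ) : ℝ) * (R / 2) ^ 2 = R ^ 2 by push_cast; ring]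
        exact sqrt_sq hR

/-- **Gaussian mass of a ball in `ℝ⁴`**: for `b, R > 0` with `2 e^{-b R²/4}/(R b) ≤ √(π/b)`,
`(√(π/b) - 2 e^{-b R²/4}/(R b))⁴ ≤ ∫_{‖y‖ ≤ R} e^{-b ‖y‖²} dy` (inscribed cube of half-side `R/2`, the
one-dimensional central mass `le_intervalIntegral_exp_neg_mul_sq` and evenness).  With `b = 1/(4τ)`, `R = L√τ`
the left side is `(4πτ)² (1 - (4/(L√π)) e^{-L²/16})⁴`. [folklore] -/
theorem le_setIntegral_closedBall_exp_neg_mul_norm_sq {b R : ℝ} (hb : 0 < b) (hR : 0 < R)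
    (hpos : 2 * exp (-b * R ^ 2 / 4) / (R * b) ≤ √(π / b)) :
    (√(π / b) - 2 * exp (-b * R ^ 2 / 4) / (R * b)) ^ 4 ≤
      ∫ y in Metric.closedBall (0 : EuclideanSpace ℝ (Fin 4)) R, exp (-b * ‖y‖ ^ 2) := by
  have hR2 : 0 < R / 2 := by linarith
  -- one-dimensional mass on `[-R/2, R/2]`
  have h1 := le_intervalIntegral_exp_neg_mul_sq hR2 hb
  have h1' : √(π / b) - 2 * exp (-b * R ^ 2 / 4) / (R * b) ≤ ∫ s in (-(R / 2))..(R / 2), exp (-b * s ^ 2) := by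
    rw [intervalIntegral_neg_eq_two_mul]
    have e1 : exp (-b * (R / 2) ^ 2) = exp (-b * R ^ 2 / 4) := by congr 1; ring
    have e2 : (2 : ℝ) * (R / 2) * b = R * b := by ring
    rw [e1, e2] at h1
    have e3 : √(π / b) - 2 * exp (-b * R ^ 2 / 4) / (R * b) =
        2 * (√(π / b) / 2 - exp (-b * R ^ 2 / 4) / (R * b)) := by ring
    rw [e3]
    linarith
  have h0 : 0 ≤ √(π / b) - 2 * exp (-b * R ^ 2 / 4) / (R * b) := sub_nonneg.2 hpos
  -- cube mass ≤ ball mass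
  have hint : IntegrableOn (fun y : EuclideanSpace ℝ (Fin 4) => exp (-b * ‖y‖ ^ 2))
      (Metric.closedBall (0 : EuclideanSpace ℝ (Fin 4)) R) := by
    refine ContinuousOn.integrableOn_compact (isCompact_closedBall _ _) ?_
    exact (continuous_exp.comp (continuous_const.mul (continuous_norm.pow 2))).continuousOn
  calc (√(π / b) - 2 * exp (-b * R ^ 2 / 4) / (R * b)) ^ 4
      ≤ (∫ s in (-(R / 2))..(R / 2), exp (-b * s ^ 2)) ^ 4 := by gcongr
    _ = ∫ y in {y : EuclideanSpace ℝ (Fin 4) | ∀ i, y i ∈ Icc (-(R / 2)) (R / 2)}, exp (-b * ‖y‖ ^ 2) :=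
        (setIntegral_cube_exp_neg_mul_norm_sq hR2.le b).symm
    _ ≤ ∫ y in Metric.closedBall (0 : EuclideanSpace ℝ (Fin 4)) R, exp (-b * ‖y‖ ^ 2) :=
        setIntegral_mono_set hint (Eventually.of_forall fun y => (exp_pos _).le)
          (Eventually.of_forall (cube_subset_closedBall hR.le))

/-! ## Layer-cake transfer to sets dense in every centred ball -/

/-- The super-level sets of the radial Gaussian inside `B(0,R)` are centred balls: for every `t` there is
`r ∈ [0, R]` with `B(0,R) ∩ {t < e^{-b‖y‖²}} = B(0, r)` (`b > 0`). [folklore] -/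
theorem exists_ball_inter_superlevel_eq {b R : ℝ} (hb : 0 < b) (hR : 0 ≤ R) (t : ℝ) :
    ∃ r : ℝ, 0 ≤ r ∧ r ≤ R ∧
      Metric.ball (0 : EuclideanSpace ℝ (Fin 4)) R ∩ {y | t < exp (-b * ‖y‖ ^ 2)} =
        Metric.ball (0 : EuclideanSpace ℝ (Fin 4)) r := by
  rcases le_or_gt t 0 with ht | ht
  · -- the super-level set is everything
    refine ⟨R, hR, le_rfl, ?_⟩
    ext y
    simp only [mem_inter_iff, mem_setOf_eq, and_iff_left_iff_imp]
    exact fun _ => lt_of_le_of_lt ht (exp_pos _)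
  rcases le_or_gt 1 t with ht1 | ht1
  · -- the super-level set is empty
    refine ⟨0, le_rfl, hR, ?_⟩
    rw [Metric.ball_zero]
    ext y
    simp only [mem_inter_iff, mem_setOf_eq, mem_empty_iff_false, iff_false, not_and, not_lt]
    intro _
    calc exp (-b * ‖y‖ ^ 2) ≤ exp 0 := exp_le_exp.2 (by nlinarith [norm_nonneg y, sq_nonneg ‖y‖])
      _ = 1 := exp_zero
      _ ≤ t := ht1
  -- `0 < t < 1`: the radius `ρ = √(log(1/t)/b)`
  set ρ : ℝ := √(-log t / b) with hρ
  have hlogt : 0 < -log t := by rw [neg_pos]; exact log_neg ht ht1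
  have hρ0 : 0 ≤ ρ := sqrt_nonneg _
  have hρsq : ρ ^ 2 = -log t / b := sq_sqrt (div_nonneg hlogt.le hb.le)
  have key : ∀ y : EuclideanSpace ℝ (Fin 4), t < exp (-b * ‖y‖ ^ 2) ↔ ‖y‖ < ρ := by
    intro y
    rw [← log_lt_iff_lt_exp ht, ← pow_lt_pow_iff_left₀ (norm_nonneg y) hρ0 two_ne_zero, hρsq,
      lt_div_iff₀ hb]
    constructor <;> intro h <;> nlinarith
  refine ⟨min R ρ, le_min hR hρ0, min_le_left _ _, ?_⟩
  ext y
  simp only [mem_inter_iff, Metric.mem_ball, dist_zero_right, mem_setOf_eq, key, lt_min_iff]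

/-- **Layer-cake transfer.** If a measurable set `G` satisfies `vol(G ∩ B(0,r)) ≥ (1-θ) vol(B(0,r))` for every
`r ∈ (0, R]`, then `∫_{G ∩ B(0,R)} e^{-b‖y‖²} ≥ (1-θ) ∫_{B(0,R)} e^{-b‖y‖²}` (as lower Lebesgue integrals; no measurability of `G`
is needed): both
sides are layer-cake integrals (`lintegral_eq_lintegral_meas_lt`) and the super-level sets of the kernel inside
`B(0,R)` are centred balls of radius `≤ R` (`exists_ball_inter_superlevel_eq`).
[cite: LiebLoss2001, Thm. 1.13] -/
theorem lintegral_inter_ge_of_dense_in_balls {b R θ : ℝ} (hb : 0 < b) (hR : 0 < R)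
    {G : Set (EuclideanSpace ℝ (Fin 4))}
    (hdense : ∀ r : ℝ, 0 < r → r ≤ R →
      ENNReal.ofReal (1 - θ) * volume (Metric.ball (0 : EuclideanSpace ℝ (Fin 4)) r) ≤
        volume (G ∩ Metric.ball (0 : EuclideanSpace ℝ (Fin 4)) r)) :
    ENNReal.ofReal (1 - θ) *
        ∫⁻ y in Metric.ball (0 : EuclideanSpace ℝ (Fin 4)) R, ENNReal.ofReal (exp (-b * ‖y‖ ^ 2)) ≤
      ∫⁻ y in G ∩ Metric.ball (0 : EuclideanSpace ℝ (Fin 4)) R, ENNReal.ofReal (exp (-b * ‖y‖ ^ 2)) := by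
  have hfm : Measurable fun y : EuclideanSpace ℝ (Fin 4) => exp (-b * ‖y‖ ^ 2) :=
    (continuous_exp.comp (continuous_const.mul (continuous_norm.pow 2))).measurable
  have hfnn : ∀ y : EuclideanSpace ℝ (Fin 4), 0 ≤ exp (-b * ‖y‖ ^ 2) := fun y => (exp_pos _).le
  have hlev : ∀ t : ℝ, MeasurableSet {y : EuclideanSpace ℝ (Fin 4) | t < exp (-b * ‖y‖ ^ 2)} := fun t =>
    measurableSet_lt measurable_const hfm
  -- layer cake on both sides
  rw [lintegral_eq_lintegral_meas_lt _ (Eventually.of_forall hfnn) hfm.aemeasurable,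
    lintegral_eq_lintegral_meas_lt _ (Eventually.of_forall hfnn) hfm.aemeasurable, ← lintegral_const_mul _ ?_]
  swap
  · exact (Antitone.measurable (fun s t hst =>
      measure_mono fun y (hy : t < _) => lt_of_le_of_lt hst hy))
  refine lintegral_mono fun t => ?_
  obtain ⟨r, hr0, hrR, hEq⟩ := exists_ball_inter_superlevel_eq hb hR.le t
  have e1 : {y : EuclideanSpace ℝ (Fin 4) | t < exp (-b * ‖y‖ ^ 2)} ∩ Metric.ball 0 R = Metric.ball 0 r := by
    rw [inter_comm]; exact hEq
  have e2 : {y : EuclideanSpace ℝ (Fin 4) | t < exp (-b * ‖y‖ ^ 2)} ∩ (G ∩ Metric.ball 0 R) =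
      G ∩ Metric.ball 0 r := by
    rw [inter_left_comm, e1]
  rw [Measure.restrict_apply (hlev t), Measure.restrict_apply (hlev t), e1, e2]
  rcases eq_or_lt_of_le hr0 with h0 | hpos
  · rw [← h0, Metric.ball_zero]; simp
  · exact hdense r hpos hrR

end Summit.SmoothPoincare4.SmoothPoincare4.Theorems.GaussianMass

end
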